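import Summits.AnomalousDissipation.AnomalousDissipation.Theorems.SolenoidalFractalHomogenisationLagrangianStepVmodFfTextsP
import Summits.AnomalousDissipation.AnomalousDissipation.Theorems.SolenoidalFractalHomogenisationLagrangianStepVmodFfAssembly
import Summits.AnomalousDissipation.AnomalousDissipation.Theorems.SolenoidalFractalHomogenisationLagrangianStepVmodFfRest
import Summits.AnomalousDissipation.AnomalousDissipation.Theorems.SolenoidalFractalHomogenisationLagrangianStepVmodSfModeGrid
import HarnessLib

/-!
# K1L_D (stmt-AnomalousDissipation-27980): (V_mod) FLAT STAGE — the GRID-PHASE (ff) block FROM its per-label text: `bffP_of_ffModeP`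
# (prover ad-k3l-bookkeeping-p1 g10; RULING D28-9 / D28-17 (a) assign the (ff) grid twin to the k3l lineage; `--kind proof --supports 27980 --as helper`)

**`bffP_of_ffModeP : (0 < e σ ≤ 1/2) → FFModeP_textEVH e → Bff_textEVHP e`** (PROVED).  Given the binders of `Bff_textEVHP e` (fast datum `x`, fast
test `ζ`, grid start `s = j·P`, `P = M·W.period/ν`):
* SHORT `t − s ≤ P`: `VmodFlat.short_pairing_le_of_fast` (ad-k3l g9, p721237) gives `C_s·√q·√q*`;
* LONG `P < t − s` (`y := P/(t−s) ∈ (0,1)`): `⟪Ux − Tx, ζ⟫ = ⟪Ux, ζ⟫ − ⟪Tx, ζ⟫`.  The coarse member KILLS fast data: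
  `‖T x‖ ≤ exp(−X)‖x‖`, `X := π²ν(lo/Λ)(t−s)/64 = (a₁/32)/y` (`norm_sq_apply_le_exp_of_supp` at `|k|² ≥ (n/4)²+1 ≥ n²/256`), and
  `exp(−(a₁/32)/y) ≤ y^{eσ}/√(a₁/32)` (`exp_neg_div_le_rpow_div_sqrt`, uses `e σ ≤ 1/2`).  The cell member is assembled by
  `abs_inner_le_of_fast_classData` (`…VmodFfAssembly`, p728242) from the per-label text `FFModeP_textEVH e` (uniform `η = C₂(C₂a + m′)`) and the
  REST decay `VmodGen.norm_apply_rest_le` (`…VmodFfRest`): `exp(−4π²ν(lo/Λ)((n/4)²/n²)(t−s)) ≤ exp(−X) ≤ y^{eσ}/√(a₁/32)` when `n ≥ 4`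
  (`(n/4)² ≥ n²/256`), and `≤ 1 ≤ √(3/K)·ν^{eσ}` when `n ≤ 3` (then `⌈K/ν⌉ ≤ 3` forces `ν ≥ K/3`, and `ν^{eσ} ≥ √ν`).
  Currencies: `d_F‖x‖² ≤ q_T(x)`, `d_F‖ζ‖² ≤ q*_T(ζ)` (`lossFwd_ge_of_supp` / `lossAdj_ge_of_supp`, `d_F := 1 − exp(−π²·lo·M·W.period/(32Λ))`).
Constant: `C₄ := C_s + 3D/d_F`, `D := C₂ + 2/√(a₁/32) + √(3/K) + 1`.  `sorry`-free; NOT a proof of (ff) by itself (the text `FFModeP_textEVH` is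
`ffModeP_grid`, companion file), of `stub_Vmod_EHTthg`, of K1L_D or AD; rung F-D1.A0.
-/

set_option linter.dupNamespace false

noncomputable section

namespace Summit.AnomalousDissipation.AnomalousDissipation.Theorems.SolenoidalFractalHomogenisation.LagrangianStep.VmodFlat

open Literature.Analysis Literature.Analysis.FluidPDE Literature.Analysis.FunctionSpaces
open MeasureTheory Set Filter UnitAddTorus
open scoped ENNReal NNReal InnerProductSpace
open Summit.AnomalousDissipation.AnomalousDissipation.Theorems.SolenoidalFractalHomogenisation.LagrangianStep.CellClauseMod
open Summit.AnomalousDissipation.AnomalousDissipation.Theorems.SolenoidalFractalHomogenisation.LagrangianStep.LossCurrency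
open Summit.AnomalousDissipation.AnomalousDissipation.Theorems.SolenoidalFractalHomogenisation.RealisedQuasiStaticCellLaw
  (isSmooth_cell isDivFree_cell memLp_top_stLift_cell)

/-! ## §1 Scalar helpers -/

/-- `(n/4 : ℕ)² / n² ≥ 1/256` for `n ≥ 4` (integer division). [folklore] -/
theorem quarter_sq_div_sq_ge {n : ℕ} (hn : 4 ≤ n) : (1 : ℝ) / 256 ≤ (((n / 4 : ℕ) : ℝ)) ^ 2 / (n : ℝ) ^ 2 := by
  have hn0 : (0:ℝ) < n := by exact_mod_cast (show 0 < n by omega)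
  have h1 : (n : ℝ) ≤ 16 * (((n / 4 : ℕ) : ℝ)) := by
    have h2 : n ≤ 16 * (n / 4) := by omega
    exact_mod_cast h2
  rw [div_le_div_iff₀ (by norm_num) (by positivity), one_mul]
  nlinarith [h1, hn0]

/-- The long-row allowance algebra: with `D ≥ 1`, `D ≥ C₂ ≥ 0`, `D ≥ c_r`, `D ≥ c_K ≥ 0`, `a, m ≥ 0`,
`C₂(C₂a + m) + (c_r·m + c_K·a) + c_r·m ≤ 3·D·(D·a + m)`. [folklore] -/
theorem three_pieces_le {C₂ cr cK D a m : ℝ} (hC₂ : 0 ≤ C₂) (hcK : 0 ≤ cK) (hD1 : 1 ≤ D) (hDC : C₂ ≤ D) (hDr : cr ≤ D)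
    (hDK : cK ≤ D) (ha : 0 ≤ a) (hm : 0 ≤ m) :
    C₂ * (C₂ * a + m) + (cr * m + cK * a) + cr * m ≤ 3 * D * (D * a + m) := by
  have hD0 : 0 ≤ D := by linarith
  have h1 : C₂ * (C₂ * a + m) ≤ D * (D * a + m) :=
    mul_le_mul hDC (add_le_add_left (mul_le_mul_of_nonneg_right hDC ha) m) (by positivity) hD0
  have h2 : cr * m ≤ D * m := mul_le_mul_of_nonneg_right hDr hm
  have h3 : cK * a ≤ D * (D * a) := by
    have : cK * a ≤ D * a := mul_le_mul_of_nonneg_right hDK ha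
    have : D * a ≤ D * (D * a) := by nlinarith [mul_nonneg hD0 ha]
    linarith
  nlinarith [mul_nonneg hD0 ha, mul_nonneg hD0 hm]

/-- `3D(Da + m)/d ≤ (Cs + 3D/d)((Cs + 3D/d)a + m)` for `0 < d ≤ 1`, `Cs, D, a, m ≥ 0`. [folklore] -/
theorem three_div_le_alw {Cs D d a m : ℝ} (hCs : 0 ≤ Cs) (hD : 0 ≤ D) (hd : 0 < d) (hd1 : d ≤ 1) (ha : 0 ≤ a) (hm : 0 ≤ m) :
    3 * D * (D * a + m) / d ≤ (Cs + 3 * D / d) * ((Cs + 3 * D / d) * a + m) := by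
  have hX : 3 * D / d ≤ Cs + 3 * D / d := by linarith
  have hX0 : 0 ≤ 3 * D / d := by positivity
  have h1 : 3 * D * (D * a + m) / d ≤ (3 * D / d) * ((3 * D / d) * a + m) := by
    rw [div_le_iff₀ hd]
    have e1 : (3 * D / d) * ((3 * D / d) * a + m) * d = 3 * D * ((3 * D / d) * a + m) := by field_simp
    rw [e1]
    have h2 : D * a ≤ (3 * D / d) * a := by
      refine mul_le_mul_of_nonneg_right ?_ ha
      rw [le_div_iff₀ hd]; nlinarith
    nlinarith [h2, hD]
  exact h1.trans (mul_le_mul hX (add_le_add_left (mul_le_mul_of_nonneg_right hX ha) m) (by positivity) (hX0.trans hX))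

/-! ## §2 The grid-phase reduction -/

set_option maxHeartbeats 3200000 in
/-- **(ff)ᴾ FROM ITS PER-LABEL TEXT AT GRID STARTS**, for every exponent map with `0 < e σ ≤ 1/2`.  See the module docstring. -/
theorem bffP_of_ffModeP (e : ℝ → ℝ) (he : ∀ σ, 0 < σ → 0 < e σ ∧ e σ ≤ 1 / 2) (h : FFModeP_textEVH e) : Bff_textEVHP e := by
  intro k W M hM c hc Φ lo hi Λ β σ C ν₀ K hlo hlo1 hhi hΛ hβ hσ hC hν₀ hν₀1 hK hV hH
  obtain ⟨C₂, hC₂, hmode⟩ := h k W M hM c hc Φ lo hi Λ β σ C ν₀ K hlo hlo1 hhi hΛ hβ hσ hC hν₀ hν₀1 hK hV hH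
  obtain ⟨he0, he1⟩ := he σ hσ
  have hΛ0 : 0 < Λ := by linarith
  have hloΛ : 0 < lo / Λ := div_pos hlo hΛ0
  have hWp : 0 < W.period :=
    Summit.AnomalousDissipation.AnomalousDissipation.Theorems.SolenoidalFractalHomogenisation.PermissibleCarrier.period_pos W
  have hMW : 0 < M * W.period := mul_pos hM hWp
  -- ### the constants
  set Cs : ℝ := 2 * k * Λ / (c * lo) + 2 * k * Real.sqrt (M * W.period * Λ / (c * lo)) + (2 / c + 1) * Λ * (hi * Λ + β / 2) / lo + 16 with hCs
  have hCs0 : 0 ≤ Cs := by rw [hCs]; positivity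
  set rF : ℝ := Real.pi ^ 2 * (lo / Λ) * (M * W.period) / 32 with hrF
  have hrF0 : 0 < rF := by rw [hrF]; positivity
  set dF : ℝ := 1 - Real.exp (-rF) with hdF
  have hdF0 : 0 < dF := by rw [hdF]; have := Real.exp_lt_one_iff.2 (neg_neg_of_pos hrF0); linarith
  have hdF1 : dF ≤ 1 := by rw [hdF]; have := Real.exp_pos (-rF); linarith
  set aR : ℝ := Real.pi ^ 2 * (lo / Λ) * (M * W.period) / 64 with haR
  have haR0 : 0 < aR := by rw [haR]; positivity
  set cr : ℝ := 1 / Real.sqrt aR with hcr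
  have hcr0 : 0 ≤ cr := by rw [hcr]; positivity
  set cK : ℝ := Real.sqrt (3 / K) with hcK
  have hcK0 : 0 ≤ cK := Real.sqrt_nonneg _
  set D : ℝ := C₂ + 2 * cr + cK + 1 with hD
  have hD1 : 1 ≤ D := by rw [hD]; linarith
  have hD0 : 0 ≤ D := by linarith
  have hDC : C₂ ≤ D := by rw [hD]; linarith
  have hDr : cr ≤ D := by rw [hD]; linarith
  have hDK : cK ≤ D := by rw [hD]; linarith
  refine ⟨Cs + 3 * D / dF, by positivity, ?_⟩
  intro ν hν n hn 𝔸 hodd hwin hΦo hΦw Tw hTw U T hU hT j t s hst htT x ζ hx hζ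
  have hs : 0 ≤ s := by
    show (0:ℝ) ≤ (j : ℝ) * (M * W.period / ν)
    exact mul_nonneg (Nat.cast_nonneg j) (div_nonneg hMW.le hν.1.le)
  have hν1 : ν ≤ 1 := by linarith [hν.2]
  have hceil1 : (1:ℝ) ≤ ⌈K / ν⌉₊ := by
    have : 0 < K / ν := div_pos hK hν.1
    exact_mod_cast Nat.one_le_iff_ne_zero.2 (Nat.pos_iff_ne_zero.1 (Nat.ceil_pos.2 this))
  have hn1 : (1:ℝ) ≤ n := hceil1.trans hn
  have hnpos : 0 < n := by exact_mod_cast (show (0:ℝ) < n by linarith)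
  have hn0 : (0:ℝ) < n := by exact_mod_cast hnpos
  have hτ : 0 < t - s := sub_pos.2 hst
  -- the common currency pieces
  set a : ℝ := ν ^ e σ + ((⌈K / ν⌉₊ : ℝ) / n) ^ e σ with ha_def
  set m' : ℝ := (min 1 ((M * W.period / ν) / (t - s))) ^ e σ with hm'_def
  have hνe0 : 0 ≤ ν ^ e σ := Real.rpow_nonneg hν.1.le _
  have ha0 : 0 ≤ a := by
    have h2 : 0 ≤ ((⌈K / ν⌉₊ : ℝ) / n) ^ e σ := Real.rpow_nonneg (by positivity) _
    rw [ha_def]; linarith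
  have hνa : ν ^ e σ ≤ a := by
    have h2 : 0 ≤ ((⌈K / ν⌉₊ : ℝ) / n) ^ e σ := Real.rpow_nonneg (by positivity) _
    rw [ha_def]; linarith
  have hP0 : 0 ≤ (M * W.period / ν) / (t - s) := div_nonneg (div_nonneg hMW.le hν.1.le) hτ.le
  have hm'0 : 0 ≤ m' := by rw [hm'_def]; exact Real.rpow_nonneg (le_min zero_le_one hP0) _
  have hTc : ∀ y, ‖T s t y‖ ≤ ‖y‖ := hT.norm_le s t
  have hq0 : 0 ≤ lossFwd (T s t) x := loss_nonneg hTc x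
  have hqs0 : 0 ≤ lossAdj (T s t) ζ := lossAdj_nonneg hTc ζ
  by_cases hshort : t - s ≤ M * W.period / ν
  · -- ### SHORT ROW (ad-k3l g9's `short_pairing_le_of_fast`)
    have hS := short_pairing_le_of_fast W M hM hc Φ hlo (by linarith) hΛ.le hβ hν.1 hν1 hnpos hodd hwin hΦo hΦw hU hT hs hst htT
      hshort x ζ (Or.inl hx)
    refine hS.trans ?_
    have hm'1 : m' = 1 := by
      rw [hm'_def, min_eq_left ((one_le_div hτ).2 hshort), Real.one_rpow]
    have hfac : Cs ≤ (Cs + 3 * D / dF) * ((Cs + 3 * D / dF) * a + m') := by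
      rw [hm'1]
      have h3 : 0 ≤ 3 * D / dF := by positivity
      nlinarith [mul_nonneg (add_nonneg hCs0 h3) (mul_nonneg (add_nonneg hCs0 h3) ha0)]
    have hqq : 0 ≤ Real.sqrt (lossFwd (T s t) x) * Real.sqrt (lossAdj (T s t) ζ) := by positivity
    calc Cs * Real.sqrt (lossFwd (T s t) x) * Real.sqrt (lossAdj (T s t) ζ)
        = Cs * (Real.sqrt (lossFwd (T s t) x) * Real.sqrt (lossAdj (T s t) ζ)) := by ring
      _ ≤ (Cs + 3 * D / dF) * ((Cs + 3 * D / dF) * a + m')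
            * (Real.sqrt (lossFwd (T s t) x) * Real.sqrt (lossAdj (T s t) ζ)) := mul_le_mul_of_nonneg_right hfac hqq
      _ = _ := by rw [ha_def, hm'_def]; ring
  · -- ### LONG ROW
    rw [not_le] at hshort
    set η : ℝ := C₂ * (C₂ * a + m') with hη
    have hη0 : 0 ≤ η := by rw [hη]; exact mul_nonneg hC₂ (by positivity)
    -- `y = P/(t−s)` and `m' = y^{eσ}`
    set y : ℝ := (M * W.period / ν) / (t - s) with hy
    have hy0 : 0 < y := by rw [hy]; exact div_pos (div_pos hMW hν.1) hτ
    have hy1 : y ≤ 1 := by rw [hy, div_le_one hτ]; exact hshort.le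
    have hm'y : m' = y ^ e σ := by rw [hm'_def, min_eq_right hy1]
    have hντ : M * W.period < ν * (t - s) := by
      have := (div_lt_iff₀ hν.1).1 hshort; linarith
    -- member facts
    have hLN : 2 * (n / 4) < n := by omega
    obtain ⟨lam, hlam, hA𝔸⟩ := hwin
    obtain ⟨lam', hlam', hΦn⟩ := hΦw
    have hlam0 : 0 < lam := by linarith [hlam.1]
    have hlam'0 : 0 < lam' := by linarith [hlam'.1]
    have hcν : 0 ≤ c / ν := div_nonneg hc.le hν.1.le
    have hn2 : (0:ℝ) < 1 / (n:ℝ) ^ 2 := by positivity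
    have hcell : Torus.NearIso ((1 / (n:ℝ) ^ 2) • 𝔸) ((1 / (n:ℝ) ^ 2) * (ν * (lo / lam))) ((1 / (n:ℝ) ^ 2) * (ν * (hi * lam))) :=
      hA𝔸.smul hn2.le
    have hcell_lo : 0 < (1 / (n:ℝ) ^ 2) * (ν * (lo / lam)) := mul_pos hn2 (mul_pos hν.1 (div_pos hlo hlam0))
    have hcoarse0 : Torus.NearIso ((1 / (n:ℝ) ^ 2) • (𝔸 + (c / ν) • Φ ν ((1 / ν) • 𝔸)))
        ((1 / (n:ℝ) ^ 2) * (ν * (lo / lam) + (c / ν) * (lo / lam'))) ((1 / (n:ℝ) ^ 2) * (ν * (hi * lam) + (c / ν) * (hi * lam'))) :=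
      (hA𝔸.add (hΦn.smul hcν)).smul hn2.le
    have hloT_le : loT lo Λ c ν n ≤ (1 / (n:ℝ) ^ 2) * (ν * (lo / lam) + (c / ν) * (lo / lam')) := by
      unfold loT
      have h1 : lo / Λ ≤ lo / lam := div_le_div_of_nonneg_left hlo.le hlam0 hlam.2
      have h2 : lo / Λ ≤ lo / lam' := div_le_div_of_nonneg_left hlo.le hlam'0 hlam'.2
      have h3 : (ν + c / ν) * (lo / Λ) ≤ ν * (lo / lam) + (c / ν) * (lo / lam') := by
        have := mul_le_mul_of_nonneg_left h1 hν.1.le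
        have := mul_le_mul_of_nonneg_left h2 hcν
        nlinarith
      exact mul_le_mul_of_nonneg_left h3 hn2.le
    have hloT : 0 < loT lo Λ c ν n := by
      unfold loT
      have hνc : 0 < ν + c / ν := by have := hν.1; positivity
      exact mul_pos hn2 (mul_pos hνc hloΛ)
    have hcoarse : Torus.NearIso ((1 / (n:ℝ) ^ 2) • (𝔸 + (c / ν) • Φ ν ((1 / ν) • 𝔸)))
        (loT lo Λ c ν n) ((1 / (n:ℝ) ^ 2) * (ν * (hi * lam) + (c / ν) * (hi * lam'))) := hcoarse0.mono hloT_le le_rfl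
    have hbU : MemLp (Torus.stLift (cellField W M hM ν hν.1 n)) ∞ (volume.restrict (Ioo 0 Tw ×ˢ (univ : Set (EuclideanSpace ℝ (Fin 3))))) :=
      memLp_top_stLift_cell _ n Tw
    have hbUdiv : ∀ᵐ τ ∂(volume.restrict (Ioo (0:ℝ) Tw)), Torus.IsWeaklyDivFree (cellField W M hM ν hν.1 n τ) :=
      ae_of_all _ fun τ => (isDivFree_cell _ n τ).isWeaklyDivFree_holds (isSmooth_cell _ n τ)
    have hgrid : ∀ (j : Fin 3 → Fin n) (τ : ℝ) (y : UnitAddTorus (Fin 3)),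
        cellField W M hM ν hν.1 n τ (y + (fun i => ((((j i : ℕ) : ℝ) / n : ℝ) : UnitAddCircle))) = cellField W M hM ν hν.1 n τ y :=
      fun j τ y => by unfold cellField; exact cell_add_grid _ hnpos j τ y
    -- ### the label sets
    set S : Finset (Fin 3 → ℤ) := (Torus.freqBall (d := Fin 3) (n / 4)).erase 0 with hS
    set Z : Set (Fin 3 → ℤ) := ↑(Torus.freqBall (d := Fin 3) (n / 4)) with hZ
    have hSneg : ∀ k' ∈ S, -k' ∈ S := fun k' hk' => by
      rw [hS, Finset.mem_erase] at hk' ⊢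
      exact ⟨neg_ne_zero.2 hk'.1, (Torus.neg_mem_freqBall).2 hk'.2⟩
    have halone : ∀ ℓ ∈ S, ∀ k' ∈ S, ((∀ i, (n:ℤ) ∣ k' i - ℓ i) ∨ (∀ i, (n:ℤ) ∣ k' i + ℓ i)) → k' = ℓ ∨ k' = -ℓ :=
      fun ℓ hℓ k' hk' hpair => FlatWindow.alone_of_lt hLN (Finset.mem_of_mem_erase hℓ) (Finset.mem_of_mem_erase hk') hpair
    have hnsc : ∀ ℓ ∈ S, ¬ (∀ i, (n:ℤ) ∣ ℓ i + ℓ i) :=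
      fun ℓ hℓ => FlatWindow.not_selfConj_of_lt hLN (Finset.mem_of_mem_erase hℓ) (Finset.ne_of_mem_erase hℓ)
    have hSZ : ∀ k' ∈ S, k' ∈ Z := fun k' hk' => by rw [hZ, Finset.mem_coe]; exact Finset.mem_of_mem_erase hk'
    have hUcl : ∀ (c' : Fin 3 → ℤ) (y : V2), (∀ k', ((∀ i, (n:ℤ) ∣ k' i - c' i) ∨ (∀ i, (n:ℤ) ∣ k' i + c' i)) →
          mFourierCoeff (EuclideanSpace.complexify ∘ ⇑y) k' = 0) →
        ∀ k', ((∀ i, (n:ℤ) ∣ k' i - c' i) ∨ (∀ i, (n:ℤ) ∣ k' i + c' i)) →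
          mFourierCoeff (EuclideanSpace.complexify ∘ ⇑(U s t y)) k' = 0 :=
      fun c' y hy k' hk' => PropagatorSymm.fcoeff_apply_eq_zero_of_classes hU hcell hcell_lo hbU hbUdiv hnpos hgrid c' hs hst.le htT y hy k' hk'
    have hxZ : ∀ k' ∈ Z, fc x k' = 0 := fun k' hk' => hx k' (by rw [hZ, Finset.mem_coe] at hk'; exact hk')
    have hζZ : ∀ k' ∈ Z, fc ζ k' = 0 := fun k' hk' => hζ k' (by rw [hZ, Finset.mem_coe] at hk'; exact hk')
    -- ### the kill exponent `X = π²ν(lo/Λ)(t−s)/64 = aR/y`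
    set X : ℝ := Real.pi ^ 2 * (ν * (lo / Λ)) * (t - s) / 64 with hX
    have hXy : X = aR / y := by rw [hX, haR, hy]; field_simp
    have hkill : Real.exp (-X) ≤ cr * y ^ e σ := by
      rw [hXy, hcr]
      have h1 := exp_neg_div_le_rpow_div_sqrt haR0 hy0 hy1 he1
      exact h1.trans (le_of_eq (by ring))
    -- ### the per-label bound from the text
    have hsb : ∀ ℓ ∈ S, ∀ w : V2, w ∈ Torus.divFreeL2 (Fin 3) →
        (∀ k', mFourierCoeff (EuclideanSpace.complexify ∘ ⇑w) k' ≠ 0 → (∀ i, (n:ℤ) ∣ k' i - ℓ i) ∨ (∀ i, (n:ℤ) ∣ k' i + ℓ i)) →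
        (∀ k' ∈ Z, mFourierCoeff (EuclideanSpace.complexify ∘ ⇑w) k' = 0) →
        ∀ y' : V2, (∀ k' ∈ Z, mFourierCoeff (EuclideanSpace.complexify ∘ ⇑y') k' = 0) → |⟪U s t w, y'⟫_ℝ| ≤ η * ‖w‖ * ‖y'‖ := by
      intro ℓ hℓ w hw hwcl hwZ y' hy'
      have hyf : IsFast n y' := fun k' hk' => hy' k' (by rw [hZ, Finset.mem_coe]; exact hk')
      have hw1 : fc w ℓ = 0 := hwZ ℓ (hSZ ℓ hℓ)
      have hw2 : fc w (-ℓ) = 0 := hwZ (-ℓ) (hSZ _ (hSneg ℓ hℓ))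
      have h := hmode ν hν n hn 𝔸 hodd ⟨lam, hlam, hA𝔸⟩ hΦo ⟨lam', hlam', hΦn⟩ Tw hTw U T hU hT j t hst htT hshort ℓ hℓ w hw hwcl hw1 hw2
        y' hyf
      rw [hη, ha_def, hm'_def]
      exact h
    -- ### the rest bound
    set EU : ℝ := 4 * Real.pi ^ 2 * (ν * (lo / Λ)) * (((n / 4 : ℕ) : ℝ)) ^ 2 / (n:ℝ) ^ 2 * (t - s) with hEU
    set ηr : ℝ := Real.exp (-EU) with hηr
    have hηr0 : 0 ≤ ηr := (Real.exp_pos _).le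
    have hrest : ∀ w : V2, w ∈ Torus.divFreeL2 (Fin 3) → (∀ k' ∈ Z, mFourierCoeff (EuclideanSpace.complexify ∘ ⇑w) k' = 0) →
        (∀ ℓ ∈ S, ∀ k', ((∀ i, (n:ℤ) ∣ k' i - ℓ i) ∨ (∀ i, (n:ℤ) ∣ k' i + ℓ i)) → mFourierCoeff (EuclideanSpace.complexify ∘ ⇑w) k' = 0) →
        ∀ y' : V2, (∀ k' ∈ Z, mFourierCoeff (EuclideanSpace.complexify ∘ ⇑y') k' = 0) → |⟪U s t w, y'⟫_ℝ| ≤ ηr * ‖w‖ * ‖y'‖ := by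
      intro w hw hwZ hwS y' _
      have hw0 : ∀ k' ∈ Torus.freqBall (d := Fin 3) (n / 4), fc w k' = 0 := fun k' hk' => hwZ k' (by rw [hZ, Finset.mem_coe]; exact hk')
      have hdec := VmodGen.norm_apply_rest_le hlo (by linarith) hΛ.le hν hnpos ⟨lam, hlam, hA𝔸⟩ hU w hw hw0 hwS hs hst.le htT
      calc |⟪U s t w, y'⟫_ℝ| ≤ ‖U s t w‖ * ‖y'‖ := abs_real_inner_le_norm _ _
        _ ≤ (Real.exp (-EU) * ‖w‖) * ‖y'‖ := mul_le_mul_of_nonneg_right hdec (norm_nonneg _)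
        _ = ηr * ‖w‖ * ‖y'‖ := by rw [hηr]
    -- `ηr ≤ cr·m' + cK·a`
    have hηr_le : ηr ≤ cr * m' + cK * a := by
      by_cases hn4 : 4 ≤ n
      · -- `EU ≥ X`
        have hq := quarter_sq_div_sq_ge hn4
        have hEX : X ≤ EU := by
          rw [hX, hEU]
          have h0 : 0 ≤ 4 * Real.pi ^ 2 * (ν * (lo / Λ)) * (t - s) := by have := hν.1; positivity
          have := mul_le_mul_of_nonneg_left hq h0
          have e1 : 4 * Real.pi ^ 2 * (ν * (lo / Λ)) * (t - s) * (1 / 256) = Real.pi ^ 2 * (ν * (lo / Λ)) * (t - s) / 64 := by ring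
          have e2 : 4 * Real.pi ^ 2 * (ν * (lo / Λ)) * (t - s) * ((((n / 4 : ℕ) : ℝ)) ^ 2 / (n:ℝ) ^ 2)
              = 4 * Real.pi ^ 2 * (ν * (lo / Λ)) * (((n / 4 : ℕ) : ℝ)) ^ 2 / (n:ℝ) ^ 2 * (t - s) := by ring
          linarith
        have h1 : ηr ≤ Real.exp (-X) := by rw [hηr]; exact Real.exp_le_exp.2 (neg_le_neg hEX)
        have h2 : 0 ≤ cK * a := mul_nonneg hcK0 ha0
        rw [hm'y]; linarith [hkill]
      · -- `n ≤ 3`: the floor `ν ≥ K/3` pays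
        rw [not_le] at hn4
        have hn3 : (n:ℝ) ≤ 3 := by exact_mod_cast (show n ≤ 3 by omega)
        have hKν : K / 3 ≤ ν := by
          have h1 : K / ν ≤ (⌈K / ν⌉₊ : ℝ) := Nat.le_ceil _
          have h2 : K / ν ≤ 3 := h1.trans (hn.trans hn3)
          rw [div_le_iff₀ hν.1] at h2
          linarith
        have hK3 : 0 < K / 3 := by positivity
        have hνe : Real.sqrt (K / 3) ≤ ν ^ e σ := by
          calc Real.sqrt (K / 3) ≤ Real.sqrt ν := Real.sqrt_le_sqrt hKν
            _ = ν ^ (1 / 2 : ℝ) := Real.sqrt_eq_rpow ν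
            _ ≤ ν ^ e σ := Real.rpow_le_rpow_of_exponent_ge hν.1 hν1 he1
        have hone : 1 ≤ cK * ν ^ e σ := by
          have h1 : cK * Real.sqrt (K / 3) = 1 := by
            rw [hcK, ← Real.sqrt_mul (by positivity)]
            rw [show (3:ℝ) / K * (K / 3) = 1 by field_simp]
            exact Real.sqrt_one
          have h2 := mul_le_mul_of_nonneg_left hνe hcK0
          linarith
        have h3 : ηr ≤ 1 := by
          rw [hηr]; apply Real.exp_le_one_iff.2
          have : 0 ≤ EU := by rw [hEU]; have := hν.1; positivity
          linarith
        have h4 : cK * ν ^ e σ ≤ cK * a := mul_le_mul_of_nonneg_left hνa hcK0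
        have h5 : 0 ≤ cr * m' := mul_nonneg hcr0 hm'0
        linarith
    -- ### the cell member by the assembly
    have hUpart : |⟪U s t x, ζ⟫_ℝ| ≤ (η + ηr) * ‖x‖ * ‖ζ‖ :=
      abs_inner_le_of_fast_classData S Z (U s t) η ηr hnpos hSneg halone hnsc hη0 hηr0 (fun y => hU.apply_eq_apply_starProjection s t y)
        hUcl hsb hrest x ζ hxZ hζZ
    -- ### the coarse member kills the fast datum
    set mF : ℝ := (((n / 4 : ℕ) : ℝ)) ^ 2 + 1 with hmF
    have hmF0 : 0 ≤ mF := by positivity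
    have hxsupp : ∀ k', fc x k' ≠ 0 → mF ≤ Torus.freqNormSq k' := fun k' hk' =>
      freqNormSq_ge_of_not_mem_freqBall fun hmem => hk' (hx k' hmem)
    have hζsupp : ∀ k', fc ζ k' ≠ 0 → mF ≤ Torus.freqNormSq k' := fun k' hk' =>
      freqNormSq_ge_of_not_mem_freqBall fun hmem => hk' (hζ k' hmem)
    have h2X : 2 * X ≤ 8 * Real.pi ^ 2 * loT lo Λ c ν n * mF * (t - s) := by
      have h1 : (n:ℝ) ^ 2 / 256 ≤ mF := sq_div_le_quarter_sq_add_one n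
      have h2 : ν * (lo / Λ) / 256 ≤ loT lo Λ c ν n * mF := by
        unfold loT
        have hνc : ν ≤ ν + c / ν := by linarith
        calc ν * (lo / Λ) / 256 = (1 / (n:ℝ) ^ 2 * (ν * (lo / Λ))) * ((n:ℝ) ^ 2 / 256) := by field_simp
          _ ≤ (1 / (n:ℝ) ^ 2 * ((ν + c / ν) * (lo / Λ))) * mF :=
              mul_le_mul (mul_le_mul_of_nonneg_left (mul_le_mul_of_nonneg_right hνc hloΛ.le) hn2.le) h1 (by positivity)
                (by positivity)
      have h3 := mul_le_mul_of_nonneg_right (mul_le_mul_of_nonneg_left h2 (by positivity : (0:ℝ) ≤ 8 * Real.pi ^ 2)) hτ.le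
      have e4 : 8 * Real.pi ^ 2 * (ν * (lo / Λ) / 256) * (t - s) = 2 * X := by rw [hX]; ring
      have e5 : 8 * Real.pi ^ 2 * (loT lo Λ c ν n * mF) * (t - s) = 8 * Real.pi ^ 2 * loT lo Λ c ν n * mF * (t - s) := by ring
      linarith
    have hTx : ‖T s t x‖ ≤ Real.exp (-X) * ‖x‖ := by
      have h1 := norm_sq_apply_le_exp_of_supp hcoarse hloT (fun _ _ => rfl) hT hs hst.le htT x hmF0 hxsupp
      have h2 : Real.exp (-(8 * Real.pi ^ 2 * loT lo Λ c ν n * mF * (t - s))) ≤ Real.exp (-X) ^ 2 := by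
        rw [← Real.exp_nat_mul]; push_cast
        exact Real.exp_le_exp.2 (by linarith)
      have h3 : ‖T s t x‖ ^ 2 ≤ (Real.exp (-X) * ‖x‖) ^ 2 := by
        rw [mul_pow]; exact h1.trans (mul_le_mul_of_nonneg_right h2 (sq_nonneg _))
      exact (pow_le_pow_iff_left₀ (norm_nonneg _) (by positivity) two_ne_zero).1 h3
    have hTpart : |⟪T s t x, ζ⟫_ℝ| ≤ (cr * m') * ‖x‖ * ‖ζ‖ := by
      calc |⟪T s t x, ζ⟫_ℝ| ≤ ‖T s t x‖ * ‖ζ‖ := abs_real_inner_le_norm _ _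
        _ ≤ (Real.exp (-X) * ‖x‖) * ‖ζ‖ := mul_le_mul_of_nonneg_right hTx (norm_nonneg _)
        _ ≤ (cr * m' * ‖x‖) * ‖ζ‖ := by
            rw [hm'y]
            exact mul_le_mul_of_nonneg_right (mul_le_mul_of_nonneg_right hkill (norm_nonneg _)) (norm_nonneg _)
        _ = (cr * m') * ‖x‖ * ‖ζ‖ := by ring
    -- ### the total coefficient
    have htot : |⟪U s t x - T s t x, ζ⟫_ℝ| ≤ 3 * D * (D * a + m') * (‖x‖ * ‖ζ‖) := by
      have h1 : |⟪U s t x - T s t x, ζ⟫_ℝ| ≤ |⟪U s t x, ζ⟫_ℝ| + |⟪T s t x, ζ⟫_ℝ| := by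
        rw [inner_sub_left]; exact abs_sub _ _
      have h2 : (η + ηr) + cr * m' ≤ 3 * D * (D * a + m') := by
        have h3 := three_pieces_le hC₂ hcK0 hD1 hDC hDr hDK ha0 hm'0
        rw [hη]; linarith [hηr_le]
      have hxζ : 0 ≤ ‖x‖ * ‖ζ‖ := by positivity
      calc |⟪U s t x - T s t x, ζ⟫_ℝ| ≤ |⟪U s t x, ζ⟫_ℝ| + |⟪T s t x, ζ⟫_ℝ| := h1
        _ ≤ (η + ηr) * ‖x‖ * ‖ζ‖ + (cr * m') * ‖x‖ * ‖ζ‖ := add_le_add hUpart hTpart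
        _ = ((η + ηr) + cr * m') * (‖x‖ * ‖ζ‖) := by ring
        _ ≤ 3 * D * (D * a + m') * (‖x‖ * ‖ζ‖) := mul_le_mul_of_nonneg_right h2 hxζ
    -- ### the currencies: `dF‖x‖² ≤ q_T(x)`, `dF‖ζ‖² ≤ q*_T(ζ)`
    have hexp : rF ≤ 8 * Real.pi ^ 2 * loT lo Λ c ν n * mF * (t - s) := by
      have h1 : rF ≤ 2 * X := by
        rw [hrF, hX]
        have h5 : Real.pi ^ 2 * (lo / Λ) * (M * W.period) ≤ Real.pi ^ 2 * (lo / Λ) * (ν * (t - s)) :=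
          mul_le_mul_of_nonneg_left hντ.le (by positivity)
        have e6 : 2 * (Real.pi ^ 2 * (ν * (lo / Λ)) * (t - s) / 64) = Real.pi ^ 2 * (lo / Λ) * (ν * (t - s)) / 32 := by ring
        linarith
      exact h1.trans h2X
    have hdFle : dF ≤ 1 - Real.exp (-(8 * Real.pi ^ 2 * loT lo Λ c ν n * mF * (t - s))) := by
      rw [hdF]
      have := Real.exp_le_exp.2 (neg_le_neg hexp)
      linarith
    have hsdF : 0 < Real.sqrt dF := Real.sqrt_pos.2 hdF0
    have hAζ := lossAdj_ge_of_supp hcoarse hloT hT hs hst.le htT ζ hmF0 hζsupp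
    have hFx := lossFwd_ge_of_supp hcoarse hloT (fun _ _ => rfl) hT hs hst.le htT x hmF0 hxsupp
    have hζcur : dF * ‖ζ‖ ^ 2 ≤ lossAdj (T s t) ζ := (mul_le_mul_of_nonneg_right hdFle (sq_nonneg _)).trans hAζ
    have hxcur : dF * ‖x‖ ^ 2 ≤ lossFwd (T s t) x := (mul_le_mul_of_nonneg_right hdFle (sq_nonneg _)).trans hFx
    have hζnorm : ‖ζ‖ ≤ Real.sqrt (lossAdj (T s t) ζ) / Real.sqrt dF := by
      rw [le_div_iff₀ hsdF, ← Real.sqrt_sq (norm_nonneg ζ), ← Real.sqrt_mul (sq_nonneg _)]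
      exact Real.sqrt_le_sqrt (by linarith [mul_comm dF (‖ζ‖ ^ 2)])
    have hxnorm : ‖x‖ ≤ Real.sqrt (lossFwd (T s t) x) / Real.sqrt dF := by
      rw [le_div_iff₀ hsdF, ← Real.sqrt_sq (norm_nonneg x), ← Real.sqrt_mul (sq_nonneg _)]
      exact Real.sqrt_le_sqrt (by linarith [mul_comm dF (‖x‖ ^ 2)])
    have hprod : ‖x‖ * ‖ζ‖ ≤ Real.sqrt (lossFwd (T s t) x) * Real.sqrt (lossAdj (T s t) ζ) / dF := by
      have h1 := mul_le_mul hxnorm hζnorm (norm_nonneg _) (by positivity)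
      have e2 : Real.sqrt (lossFwd (T s t) x) / Real.sqrt dF * (Real.sqrt (lossAdj (T s t) ζ) / Real.sqrt dF)
          = Real.sqrt (lossFwd (T s t) x) * Real.sqrt (lossAdj (T s t) ζ) / dF := by
        rw [div_mul_div_comm, ← pow_two, Real.sq_sqrt hdF0.le]
      rw [e2] at h1; exact h1
    -- ### conclusion
    have hcoef0 : 0 ≤ 3 * D * (D * a + m') := by positivity
    calc |⟪U s t x - T s t x, ζ⟫_ℝ| ≤ 3 * D * (D * a + m') * (‖x‖ * ‖ζ‖) := htot
      _ ≤ 3 * D * (D * a + m') * (Real.sqrt (lossFwd (T s t) x) * Real.sqrt (lossAdj (T s t) ζ) / dF) :=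
          mul_le_mul_of_nonneg_left hprod hcoef0
      _ = (3 * D * (D * a + m') / dF) * Real.sqrt (lossFwd (T s t) x) * Real.sqrt (lossAdj (T s t) ζ) := by ring
      _ ≤ ((Cs + 3 * D / dF) * ((Cs + 3 * D / dF) * a + m')) * Real.sqrt (lossFwd (T s t) x) * Real.sqrt (lossAdj (T s t) ζ) := by
          have hfac := three_div_le_alw hCs0 hD0 hdF0 hdF1 ha0 hm'0
          gcongr
      _ = _ := by rw [ha_def, hm'_def]

end Summit.AnomalousDissipation.AnomalousDissipation.Theorems.SolenoidalFractalHomogenisation.LagrangianStep.VmodFlat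

end
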